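import Literature.Geometry.Kaehler.ComplexTorusHodgeGroupProductStablePlanes
import Literature.Geometry.Kaehler.ComplexTorusSimpleTotallyRealCenterTimesCM
import Literature.Geometry.Kaehler.ComplexTorusAbelianSurfaceRealMultiplicationHodgeEqLefschetz
import Literature.Geometry.Kaehler.ComplexTorusAbelianSurfaceRealMultiplicationHodgeLieAlgebraDimension
import Literature.Geometry.Kaehler.ComplexTorusAbelianSurfaceQuaternionMultiplicationHodgeEqLefschetz
import Literature.Geometry.Kaehler.ComplexTorusAbelianSurfaceQuaternionMultiplicationHodgeLieAlgebraDimension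
import Literature.Geometry.Kaehler.ComplexTorusAbelianSurfaceComplexMultiplicationHodgeLieAlgebraDimension
import Literature.Geometry.Kaehler.ComplexTorusAbelianSurfaceFirstKindHodgeEqLefschetz
import Literature.Geometry.Kaehler.ComplexTorusMaximalRealMultiplicationHodgeLieAlgebra
import Literature.Geometry.Kaehler.ComplexTorusHodgeLieAlgebraCartanPTrivial
import HarnessLib

/-!
# Two simple abelian surfaces with non-commutative Hodge groups: `Hg(Y₁ × Y₂) = Hg(Y₁) × Hg(Y₂)` unless `Y₁ ∼ Y₂`
# (Hazama's Thm. (3.2)(1) at `g = 2 + 2`), and Moonen–Zarhin (0.1)(4) for `Y₁ × Y₂` outside the CM × CM case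

Lane `lit-hodgefound`, seat p17, generation 52, self-proposed row g52-#7 — the INSTANCES of g52-#6
(`IsSimple.hodgeGroupC_prod_eq_blockDiagProd_of_stablePlanes_of_not_isIsogenous`): a simple polarised abelian surface `Y`
with non-commutative Hodge group and `End_ℚ(Y) ≠ ℚ` is of type I(2) (real multiplication by a quadratic field `K`:
`V_ℂ = V_σ ⊕ V_τ`, `𝔤 = 𝔰𝔩(V_σ) × 𝔰𝔩(V_τ)`, `dim 𝔤 = 6`) or II(1) (quaternion multiplication: `V_ℂ = U ⊕ e₁₀U`, `𝔤 ≅ 𝔰𝔩(U)`,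
`dim 𝔤 = 3`), and in both cases its `𝔤` is read on `𝔰𝔩₂`-PLANES; two such non-isogenous surfaces therefore have split Hodge
group, and condition (D) follows for `Y₁ × Y₂` — which, with g51-#7, g52-#2, g52-#3, settles Moonen–Zarhin's (0.1)(4) for
`X ∼ Y₁ × Y₂` in every case except «both simple of CM type, non-isogenous» (MZ Prop. (4.2)).  THEOREMS ONLY (no definition,
no instance, no notation, no named fact; D-0026 net debt 0).

## Sources, verbatim

* B. Moonen, Yu. G. Zarhin [MoonenZarhin1999LowDim], held `paper:arxiv-math_9901113`: Thm. (0.1)(4) (p0001 L131–L135); §2 (2.2)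
  `g = 2` (p0005 L53–L78: «Type I(2) … `Hg(X) = Res_{F/ℚ} SL_{2,F}`», «Type II(1) … `Hg(X)` is the algebraic group `U_{D^opp}`»,
  «Type IV(2,1) … `Hg(X) = U_F`»); §3 Thm. (3.2)(1) (Hazama) (p0006 L69–L74: «Suppose `X₁` and `X₂` contain no factors of Type IV.
  Then `X₁ × X₂` again satisfies (D), and either `Hom(X₁, X₂) ≠ 0` or `Hg(X₁ × X₂) = Hg(X₁) × Hg(X₂)`»); proof of (3.3)
  (p0006 L94–L104); §5 (5.4)–(5.5) (p0009 L82–L106: «If `X₁` and `X₂` are not isogenous then Proposition (4.2) shows …»).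
* F. Hazama [Hazama1983], Thm. (3.2)(1) as quoted by Moonen–Zarhin.
* J. S. Milne [Milne1999LefschetzClasses], §2 («Simple abelian variety of type I ∕ II», pp. 649–650).

## What is proved

* §1 **`IsRiemannForm.exists_sl2StablePlanes_of_finrank_eq_two`** (type I(2): the eigenplanes `V_σ`, `σ : K → ℂ`) and
  **`IsSimple.exists_sl2StablePlanes_of_isAlbertTypeII_of_finrank_eq_two`** (type II(1): the plane `e₀₀V_ℂ`): the `𝔰𝔩₂`-plane
  hypotheses of g52-#6 (stable planes, tracelessness, joint faithfulness, `dim 𝔤 = 3 · #planes`).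
* §2 **`IsSimple.exists_sl2StablePlanes_of_not_hodgeGroup_comm_of_endAlgRat_ne_bot_of_finrank_eq_two`**: every simple polarised
  surface with non-commutative Hodge group and `End_ℚ ≠ ℚ` carries such planes (Albert: I(2) or II(1); III impossible, IV is CM).
* §3 **`IsSimple.hodgeGroupC_prod_eq_blockDiagProd_of_not_hodgeGroup_comm_of_finrank_eq_two`** — two simple non-isogenous
  surfaces with non-commutative Hodge groups and `End_ℚ ≠ ℚ` have split Hodge group; **(D) for `Y₁ × Y₂`** in that case; and the
  assembly **`…_of_finrank_eq_two_of_not_hodgeGroup_comm_or`**: (0.1)(4) for `Y₁ × Y₂` unless both Hodge groups are commutative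
  (with both simple, non-isogenous, `End_ℚ ≠ ℚ`: the CM × CM case of MZ Prop. (4.2)).

## References

* [MoonenZarhin1999LowDim] B. Moonen, Yu. G. Zarhin, Math. Ann. 315 (1999), Thm. (0.1)(4), §2 (2.2), §3 (3.1)–(3.5) (the «U_1^d ⊕ ⋯ ⊕ U_e^d» argument quoted below is the proof of Lemma (3.3), chunk p0006 L94–L104, arXiv v2 = Math. Ann. numbering; earlier tree copies of this family wrote «(3.4)»), §5 (5.4)–(5.5).
* [Hazama1983] F. Hazama, J. Fac. Sci. Univ. Tokyo 31 (1984) 487–520, Thm. (3.2).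
* [Milne1999LefschetzClasses] J. S. Milne, *Lefschetz classes on abelian varieties*, Duke Math. J. 96 (1999), §2.
-/

noncomputable section

open Matrix Module NumberField

namespace Literature.Geometry.Kaehler

namespace ComplexTorus

open Literature.NumberTheory.Automorphic (lieAlgebraGL)
open Literature.RingTheory.CentralSimple (IsAlbertTypeI IsAlbertTypeII IsAlbertTypeIII IsAlbertTypeIV)

/-! ### §0 Helpers (file-local) -/

section Helpers

variable {ι : Type*} [Fintype ι] [DecidableEq ι] {E : Type*} [NormedAddCommGroup E] [NormedSpace ℂ E]

omit [DecidableEq ι] in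
/-- A surface has a non-empty period index (`|ι| = 4`). [folklore] -/
private theorem nonempty_of_finrank_eq_two₁₃₅ [FiniteDimensional ℂ E] (Φ : (ι → ℝ) ≃L[ℝ] E) (h2 : finrank ℂ E = 2) :
    Nonempty ι := by
  have hc := card_eq_two_mul_finrank Φ
  exact Fintype.card_pos_iff.1 (by omega)

variable (Φ : (ι → ℝ) ≃L[ℝ] E)

/-- `dim_ℂ Lie Hg(X)(ℂ) = dim_ℂ 𝔥𝔤_ℂ` (the trunk's `lieAlgebraGL` of `Hg(X)(ℂ) ≤ GL(V_ℂ)` vs. `hodgeGroupComplexLie`). [folklore] -/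
private theorem finrank_lieAlgebraGL_eq_finrank_hodgeGroupComplexLie₁₃₅ :
    finrank ℂ (lieAlgebraGL ((hodgeGroupC Φ).map Matrix.SpecialLinearGroup.toGL)) = finrank ℂ (hodgeGroupComplexLie Φ) := by
  rw [finrank_hodgeGroupComplexLie_eq_zdim, (isZConnected_map_toGL_hodgeGroupC Φ).finrank_lieAlgebraGL_eq.2]

end Helpers

/-! ## §1 The `𝔰𝔩₂`-planes of the two non-commutative, non-generic types -/

section TypeOneTwo

variable {ι : Type} [Fintype ι] [DecidableEq ι] {E : Type} [NormedAddCommGroup E] [NormedSpace ℂ E]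
  [FiniteDimensional ℂ E] {Φ : (ι → ℝ) ≃L[ℝ] E} {η : E [⋀^Fin 2]→L[ℝ] ℝ} {K : Type*} [Field K] [NumberField K]
  [IsTotallyReal K]

/-- **TYPE I(2): THE EIGENPLANES `V_σ` ARE `𝔰𝔩₂`-PLANES FOR `𝔤`.**  For a polarised complex abelian surface with real
multiplication by a quadratic field `K` (`End⁰(X) = f(K)`), the two eigenplanes `V_σ = ⋂_y ker(f(y) − σ(y))` (`σ : K → ℂ`) are
`𝔤 = Lie Hg(X)(ℂ)`-stable planes on which `𝔤` acts tracelessly and jointly faithfully (`V_ℂ = V_σ ⊕ V_τ`), and `dim_ℂ 𝔤 = 6 =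
3 · 2` («`Hg(X) = Res_{F/ℚ} SL_{2,F}`», over `ℂ`: `SL(V_σ) × SL(V_τ)`).
[cite: MoonenZarhin1999LowDim, §2 (2.2) `g = 2` («Type I(2)», p0005 L59–L64) and §3 proof of (3.3) (p0006 L94–L104)] [cite: Milne1999LefschetzClasses, §2 («Simple abelian variety of type I», p. 649)] -/
theorem IsRiemannForm.exists_sl2StablePlanes_of_finrank_eq_two (hη : IsRiemannForm Φ η) (h2 : finrank ℂ E = 2)
    (hK : finrank ℚ K = 2) (f : K →ₐ[ℚ] Matrix ι ι ℚ) (hfE : f.range = endAlgRat Φ) :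
    ∃ (U : Fin 2 → Submodule ℂ (ι → ℂ))
      (hU : ∀ a, ∀ Z ∈ lieAlgebraGL ((hodgeGroupC Φ).map Matrix.SpecialLinearGroup.toGL), ∀ u ∈ U a, Matrix.toLin' Z u ∈ U a),
      (∀ a, finrank ℂ (U a) = 2) ∧
      (∀ a Z (hZ : Z ∈ lieAlgebraGL ((hodgeGroupC Φ).map Matrix.SpecialLinearGroup.toGL)),
        LinearMap.trace ℂ _ ((Matrix.toLin' Z).restrict (hU a Z hZ)) = 0) ∧
      (∀ Z ∈ lieAlgebraGL ((hodgeGroupC Φ).map Matrix.SpecialLinearGroup.toGL),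
        (∀ a, ∀ u ∈ U a, Matrix.toLin' Z u = 0) → Z = 0) ∧
      finrank ℂ (lieAlgebraGL ((hodgeGroupC Φ).map Matrix.SpecialLinearGroup.toGL)) = 3 * Fintype.card (Fin 2) := by
  classical
  haveI : Nonempty ι := nonempty_of_finrank_eq_two₁₃₅ Φ h2
  obtain ⟨G, hGη⟩ := hη.exists_ratMatrix_latticeGram
  -- the two complex embeddings of `K`, enumerated
  have hcard : Fintype.card (K →+* ℂ) = 2 := by rw [NumberField.Embeddings.card, hK]
  obtain ⟨e⟩ : Nonempty (Fin 2 ≃ (K →+* ℂ)) := Fintype.card_eq.1 (by rw [hcard, Fintype.card_fin])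
  have hfE' : ∀ y, f y ∈ endAlgRat Φ := fun y ↦ by rw [← hfE]; exact AlgHom.mem_range_self f y
  have hGu : IsUnit G.det := isUnit_det_of_map_ratCast hGη hη.isUnit_det_latticeGram
  have hGt : Gᵀ = -G := transpose_eq_neg_of_map_ratCast Φ hGη
  have hRos : ∀ A ∈ endAlgRat Φ, rosati G A = A := fun A hA ↦ rosati_eq_self_of_range_eq Φ f hfE hη.1 hη.2.2 hGη hA
  have hsym : ∀ a : K, (f a)ᵀ * G = G * f a := forall_transpose_mul_eq_of_forall_rosati_eq f hfE' hGu hRos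
  have hLf : ∀ Z ∈ lieAlgebraGL ((hodgeGroupC Φ).map Matrix.SpecialLinearGroup.toGL), Z ∈ lefschetzLieC Φ G := fun Z hZ ↦
    hη.hodgeGroupLieC_subset_lefschetzLieC hGη ((mem_hodgeGroupLieC_iff_mem_lieAlgebraGL Φ).2 hZ)
  set U : Fin 2 → Submodule ℂ (ι → ℂ) := fun a ↦
    ⨅ y : K, Module.End.eigenspace (Matrix.toLin' ((f y).map (algebraMap ℚ ℂ))) (e a y) with hUdef
  have hU : ∀ a, ∀ Z ∈ lieAlgebraGL ((hodgeGroupC Φ).map Matrix.SpecialLinearGroup.toGL), ∀ u ∈ U a,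
      Matrix.toLin' Z u ∈ U a := fun a Z hZ ↦
    toLin'_apply_mem_iInf_eigenspace_algHom_of_mem_lefschetzLieC f hfE' (e a) (hLf Z hZ)
  refine ⟨U, hU, fun a ↦ finrank_iInf_eigenspace_eq_two f Φ h2 hK (e a), fun a Z hZ ↦
    forall_trace_restrict_eq_zero_of_mem_lefschetzLieC' f hGu.ne_zero hGt hsym (e a) (hLf Z hZ) (hU a Z hZ), fun Z _ h0 ↦ ?_, ?_⟩
  · -- `V_ℂ = V_{e 0} ⊕ V_{e 1}`: a matrix killing both planes is zero
    have h01 : e 0 ≠ e 1 := fun h ↦ absurd (e.injective h) (by decide)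
    have hsup : U 0 ⊔ U 1 = ⊤ := sup_iInf_eigenspace_eq_top_of_finrank_eq_two f hK h01
    refine Matrix.toLin'.injective (LinearMap.ext fun v ↦ ?_)
    have hv : v ∈ U 0 ⊔ U 1 := by rw [hsup]; exact Submodule.mem_top
    obtain ⟨x, hx, y, hy, rfl⟩ := Submodule.mem_sup.1 hv
    rw [map_add, h0 0 x hx, h0 1 y hy, add_zero, map_zero, LinearMap.zero_apply]
  · rw [finrank_lieAlgebraGL_eq_finrank_hodgeGroupComplexLie₁₃₅, hη.finrank_hodgeGroupComplexLie_eq_six_of_finrank_eq_two h2 hK f hfE,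
      Fintype.card_fin]

end TypeOneTwo

section TypeTwoOne

variable {κ : Type} [Fintype κ] [DecidableEq κ] [Nonempty κ] {E : Type} [NormedAddCommGroup E] [NormedSpace ℂ E]
  [FiniteDimensional ℂ E] {Ψ : (κ → ℝ) ≃L[ℝ] E} {η : E [⋀^Fin 2]→L[ℝ] ℝ} {G : Matrix κ κ ℚ}

/-- **TYPE II(1): `U = e₀₀V_ℂ` IS AN `𝔰𝔩₂`-PLANE FOR `𝔤`.**  For a simple polarised complex abelian surface with quaternion
multiplication and matrix units `e a b ∈ End⁰(X) ⊗ ℂ ≅ M₂(ℂ)`, the plane `U = e₀₀V_ℂ` is `𝔤`-stable, `𝔤` acts on it tracelessly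
and faithfully (`V_ℂ = U ⊕ e₁₀U`), and `dim_ℂ 𝔤 = 3` («`Hg(X) = U_{D^opp}`», over `ℂ`: `SL₂` acting on `St ⊗ ℂ²`).
[cite: MoonenZarhin1999LowDim, §2 (2.2) `g = 2` («Type II(1)», p0005 L65–L68) and §3 proof of (3.3) (p0006 L94–L104)] [cite: Milne1999LefschetzClasses, §2 («Simple abelian variety of type II», p. 650)] -/
theorem IsSimple.exists_sl2StablePlanes_of_isAlbertTypeII_of_finrank_eq_two (hX : IsSimple Ψ) (hη : IsRiemannForm Ψ η)
    (hG : G.map (Rat.cast : ℚ → ℝ) = latticeGram Ψ η)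
    (h : IsAlbertTypeII (centerField Ψ hX) (endAlgRat Ψ) (rosatiEnd Ψ hη.1 hη.2.2 hG)) (h2 : finrank ℂ E = 2) :
    ∃ (U : Fin 1 → Submodule ℂ (κ → ℂ))
      (hU : ∀ a, ∀ Z ∈ lieAlgebraGL ((hodgeGroupC Ψ).map Matrix.SpecialLinearGroup.toGL), ∀ u ∈ U a, Matrix.toLin' Z u ∈ U a),
      (∀ a, finrank ℂ (U a) = 2) ∧
      (∀ a Z (hZ : Z ∈ lieAlgebraGL ((hodgeGroupC Ψ).map Matrix.SpecialLinearGroup.toGL)),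
        LinearMap.trace ℂ _ ((Matrix.toLin' Z).restrict (hU a Z hZ)) = 0) ∧
      (∀ Z ∈ lieAlgebraGL ((hodgeGroupC Ψ).map Matrix.SpecialLinearGroup.toGL),
        (∀ a, ∀ u ∈ U a, Matrix.toLin' Z u = 0) → Z = 0) ∧
      finrank ℂ (lieAlgebraGL ((hodgeGroupC Ψ).map Matrix.SpecialLinearGroup.toGL)) = 3 * Fintype.card (Fin 1) := by
  classical
  obtain ⟨e, hmul, hone, hspan, -, hros⟩ := hX.exists_matrixUnits_of_isAlbertTypeII_of_finrank_eq_two hη hG h h2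
  -- the two spellings of `End⁰(X) ⊗ 1`
  have hcast : ∀ A : Matrix κ κ ℚ, A.map ((↑) : ℚ → ℂ) = A.map (algebraMap ℚ ℂ) := fun A ↦
    congrArg A.map (funext fun q ↦ (eq_ratCast (algebraMap ℚ ℂ) q).symm)
  have hset : ((fun A : Matrix κ κ ℚ ↦ A.map ((↑) : ℚ → ℂ)) '' (endAlgRat Ψ : Set (Matrix κ κ ℚ))) =
      (fun A : Matrix κ κ ℚ ↦ A.map (algebraMap ℚ ℂ)) '' (endAlgRat Ψ : Set (Matrix κ κ ℚ)) :=
    Set.image_congr fun A _ ↦ hcast A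
  have hspan' : ∀ a b, e a b ∈ Submodule.span ℂ
      ((fun A : Matrix κ κ ℚ ↦ A.map ((↑) : ℚ → ℂ)) '' (endAlgRat Ψ : Set (Matrix κ κ ℚ))) := fun a b ↦ by
    rw [hset]; exact hspan a b
  -- the Gram matrix over `ℂ`
  have hGu : IsUnit G.det := isUnit_det_of_map_ratCast hG hη.isUnit_det_latticeGram
  have hGcu : IsUnit (G.map (algebraMap ℚ ℂ)).det := by
    rw [← RingHom.mapMatrix_apply, ← RingHom.map_det]; exact hGu.map _
  have hGt : Gᵀ = -G := transpose_eq_neg_of_map_ratCast Ψ hG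
  have hGct : (G.map (algebraMap ℚ ℂ))ᵀ = -G.map (algebraMap ℚ ℂ) := by
    rw [← Matrix.transpose_map, hGt, Matrix.map_neg _ (map_neg (algebraMap ℚ ℂ))]
  have hadj : (e 0 0)ᵀ * G.map (algebraMap ℚ ℂ) = G.map (algebraMap ℚ ℂ) * e 0 0 := (rosati_eq_iff hGcu _ _).1 (hros 0 0)
  -- `Z ∈ 𝔤` commutes with the matrix units and is `E`-skew
  have hZe : ∀ Z ∈ lieAlgebraGL ((hodgeGroupC Ψ).map Matrix.SpecialLinearGroup.toGL), ∀ a b, Z * e a b = e a b * Z :=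
    fun Z hZ a b ↦ (mul_comm_of_mem_span_endAlgRat_of_mem_hodgeGroupLieC (hspan' a b)
      ((mem_hodgeGroupLieC_iff_mem_lieAlgebraGL Ψ).2 hZ)).symm
  have hskew : ∀ Z ∈ lieAlgebraGL ((hodgeGroupC Ψ).map Matrix.SpecialLinearGroup.toGL),
      Zᵀ * G.map (algebraMap ℚ ℂ) = -(G.map (algebraMap ℚ ℂ) * Z) := fun Z hZ ↦
    ((mem_lefschetzLieC_iff Ψ).1 (hη.hodgeGroupLieC_subset_lefschetzLieC hG ((mem_hodgeGroupLieC_iff_mem_lieAlgebraGL Ψ).2 hZ))).1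
  set U : Fin 1 → Submodule ℂ (κ → ℂ) := fun _ ↦ LinearMap.range (Matrix.toLin' (e 0 0)) with hUdef
  have hU : ∀ a, ∀ Z ∈ lieAlgebraGL ((hodgeGroupC Ψ).map Matrix.SpecialLinearGroup.toGL), ∀ u ∈ U a,
      Matrix.toLin' Z u ∈ U a := fun a Z hZ u hu ↦ by
    rw [Matrix.toLin'_apply]
    exact mulVec_mem_range_toLin'_of_mem_span_endAlgRat (hspan' 0 0) ((mem_hodgeGroupLieC_iff_mem_lieAlgebraGL Ψ).2 hZ) hu
  have hcardκ : Fintype.card κ = 4 := by rw [card_eq_two_mul_finrank Ψ, h2]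
  have hdU : finrank ℂ ↥(LinearMap.range (Matrix.toLin' (e 0 0))) = 2 := by
    have h2U := two_mul_finrank_range_toLin'_matrixUnits hmul hone
    rw [hcardκ] at h2U
    omega
  refine ⟨U, hU, fun _ ↦ hdU, fun a Z hZ ↦
    trace_restrict_eq_zero_of_matrixUnits hmul hone hGcu.ne_zero hGct hadj (hskew Z hZ) (hU a Z hZ), fun Z hZ h0 ↦ ?_, ?_⟩
  · -- `V_ℂ = U ⊕ e₁₀U`: a matrix commuting with `e₁₀` and killing `U` is zero
    refine eq_of_matrixUnits_of_forall_mulVec_eq hmul hone (hZe Z hZ 1 0) (by rw [Matrix.zero_mul, Matrix.mul_zero])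
      fun u hu ↦ ?_
    rw [Matrix.zero_mulVec, ← Matrix.toLin'_apply]
    exact h0 0 u hu
  · rw [finrank_lieAlgebraGL_eq_finrank_hodgeGroupComplexLie₁₃₅,
      hX.finrank_hodgeGroupComplexLie_eq_three_of_isAlbertTypeII_of_finrank_eq_two hη hG h h2, Fintype.card_fin]

end TypeTwoOne

/-! ## §2 Every simple surface with non-commutative Hodge group and `End_ℚ ≠ ℚ` carries `𝔰𝔩₂`-planes -/

section Dispatch

variable {κ : Type} [Fintype κ] [DecidableEq κ] [Nonempty κ] {E : Type} [NormedAddCommGroup E] [NormedSpace ℂ E]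
  [FiniteDimensional ℂ E] {Ψ : (κ → ℝ) ≃L[ℝ] E} {η : E [⋀^Fin 2]→L[ℝ] ℝ}

/-- **`𝔰𝔩₂`-PLANES FOR A SIMPLE SURFACE WITH NON-COMMUTATIVE HODGE GROUP AND `End_ℚ ≠ ℚ`.**  By Albert's classification at
`g = 2` (types I(1), I(2), II(1), IV(2,1); III does not occur): `Hg` non-commutative excludes IV (`Hg = U_F`, a torus:
`dim 𝔥𝔤 = 2`), `End_ℚ ≠ ℚ` excludes I(1); the remaining types I(2) and II(1) are §1.  So there are `n` planes (`n = 2` or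
`1`) in `V_ℂ`, `𝔤`-stable, with traceless and jointly faithful `𝔤`-action and `dim_ℂ 𝔤 = 3n`.
[cite: MoonenZarhin1999LowDim, §2 (2.2) `g = 2` (p0005 L53–L78) and §3 proof of (3.3) (p0006 L94–L104)] [cite: Milne1999LefschetzClasses, §2 (pp. 649–650)] -/
theorem IsSimple.exists_sl2StablePlanes_of_not_hodgeGroup_comm_of_endAlgRat_ne_bot_of_finrank_eq_two (hX : IsSimple Ψ)
    (hη : IsRiemannForm Ψ η) (h2 : finrank ℂ E = 2) (hnc : ¬ ∀ M ∈ hodgeGroup Ψ, ∀ N ∈ hodgeGroup Ψ, M * N = N * M)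
    (hE : endAlgRat Ψ ≠ ⊥) :
    ∃ (n : ℕ) (U : Fin n → Submodule ℂ (κ → ℂ))
      (hU : ∀ a, ∀ Z ∈ lieAlgebraGL ((hodgeGroupC Ψ).map Matrix.SpecialLinearGroup.toGL), ∀ u ∈ U a, Matrix.toLin' Z u ∈ U a),
      (∀ a, finrank ℂ (U a) = 2) ∧
      (∀ a Z (hZ : Z ∈ lieAlgebraGL ((hodgeGroupC Ψ).map Matrix.SpecialLinearGroup.toGL)),
        LinearMap.trace ℂ _ ((Matrix.toLin' Z).restrict (hU a Z hZ)) = 0) ∧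
      (∀ Z ∈ lieAlgebraGL ((hodgeGroupC Ψ).map Matrix.SpecialLinearGroup.toGL),
        (∀ a, ∀ u ∈ U a, Matrix.toLin' Z u = 0) → Z = 0) ∧
      finrank ℂ (lieAlgebraGL ((hodgeGroupC Ψ).map Matrix.SpecialLinearGroup.toGL)) = 3 * n := by
  obtain ⟨G, hG⟩ := hη.exists_ratMatrix_latticeGram
  rcases hX.isAlbertType_of_finrank_le_seven hη hG (by omega) with hI | hII | hIII | hIV
  · -- type I: `e = [F:ℚ] ∈ {1, 2}`; `e = 1` is `End_ℚ = ℚ`, excluded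
    haveI : IsTotallyReal (centerField Ψ hX) := hI.isTotallyReal
    have hF := hX.range_valAlgHom_eq_endAlgRat_of_finrank_eq_one hI.finrank_eq_one
    have hdvd : finrank ℚ (centerField Ψ hX) ∣ finrank ℂ E := hX.finrank_centerField_dvd_of_isTotallyReal
    rw [h2] at hdvd
    have hpos : 0 < finrank ℚ (centerField Ψ hX) := finrank_pos
    have hle : finrank ℚ (centerField Ψ hX) ≤ 2 := Nat.le_of_dvd two_pos hdvd
    rcases (show finrank ℚ (centerField Ψ hX) = 1 ∨ finrank ℚ (centerField Ψ hX) = 2 by omega) with he | he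
    · exact absurd (hX.endAlgRat_eq_bot_of_finrank_eq_one_of_finrank_centerField_eq_one hI.finrank_eq_one he) hE
    · obtain ⟨U, hU, h⟩ := hη.exists_sl2StablePlanes_of_finrank_eq_two h2 he (centerField.valAlgHom Ψ hX) hF
      exact ⟨2, U, hU, by simpa only [Fintype.card_fin] using h⟩
  · obtain ⟨U, hU, h⟩ := hX.exists_sl2StablePlanes_of_isAlbertTypeII_of_finrank_eq_two hη hG hII h2
    exact ⟨1, U, hU, by simpa only [Fintype.card_fin] using h⟩
  · exact absurd hIII (hX.not_isAlbertTypeIII_of_finrank_eq_two hη hG h2)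
  · -- type IV at `g = 2` is CM: `dim 𝔥𝔤 = 2`, so `Hg` is commutative
    exact absurd (IsAbelianVariety.hodgeGroup_comm_of_finrank_hodgeGroupLie_le_two ⟨η, hη⟩
      (hX.finrank_hodgeGroupLie_eq_two_of_isAlbertTypeIV_of_finrank_eq_two hη hG hIV h2).le) hnc

end Dispatch

/-! ## §3 Two simple surfaces with non-commutative Hodge groups; Moonen–Zarhin (0.1)(4) for `Y₁ × Y₂` outside CM × CM -/

section Surfaces

variable {ι₁ ι₂ : Type} [Fintype ι₁] [DecidableEq ι₁] [Fintype ι₂] [DecidableEq ι₂]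
  {E₁ E₂ : Type} [NormedAddCommGroup E₁] [NormedSpace ℂ E₁] [FiniteDimensional ℂ E₁] [NormedAddCommGroup E₂]
  [NormedSpace ℂ E₂] [FiniteDimensional ℂ E₂] {Φ₁ : (ι₁ → ℝ) ≃L[ℝ] E₁} {Φ₂ : (ι₂ → ℝ) ≃L[ℝ] E₂}
  {η₁ : E₁ [⋀^Fin 2]→L[ℝ] ℝ} {η₂ : E₂ [⋀^Fin 2]→L[ℝ] ℝ}

/-- **HAZAMA'S THM. (3.2)(1) FOR TWO SIMPLE SURFACES OF TYPES I(2) ∕ II(1): `Hg(Y₁ × Y₂)(ℂ) = Hg(Y₁)(ℂ) × Hg(Y₂)(ℂ)`** for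
simple non-isogenous polarised abelian surfaces `Y₁`, `Y₂` with non-commutative Hodge groups and `End_ℚ(Yᵢ) ≠ ℚ` («either
`Hom(X₁, X₂) ≠ 0` or `Hg(X₁ × X₂) = Hg(X₁) × Hg(X₂)`»; the `𝔰𝔩₂`-planes of §2 fed to g52-#6).
[cite: MoonenZarhin1999LowDim, §3 Thm. (3.2)(1) (p0006 L69–L74) and §5 (5.4) (p0009 L88–L94)] [cite: Hazama1983, Thm. (3.2)(1)] -/
theorem IsSimple.hodgeGroupC_prod_eq_blockDiagProd_of_not_hodgeGroup_comm_of_finrank_eq_two (hX₁ : IsSimple Φ₁)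
    (hX₂ : IsSimple Φ₂) (hη₁ : IsRiemannForm Φ₁ η₁) (hη₂ : IsRiemannForm Φ₂ η₂) (h2₁ : finrank ℂ E₁ = 2) (h2₂ : finrank ℂ E₂ = 2)
    (hne : ¬ IsIsogenous Φ₂ Φ₁) (hnc₁ : ¬ ∀ M ∈ hodgeGroup Φ₁, ∀ N ∈ hodgeGroup Φ₁, M * N = N * M)
    (hnc₂ : ¬ ∀ M ∈ hodgeGroup Φ₂, ∀ N ∈ hodgeGroup Φ₂, M * N = N * M) (hE₁ : endAlgRat Φ₁ ≠ ⊥) (hE₂ : endAlgRat Φ₂ ≠ ⊥) :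
    hodgeGroupC (prodPeriod Φ₁ Φ₂) = blockDiagProd (hodgeGroupC Φ₁) (hodgeGroupC Φ₂) := by
  classical
  haveI : Nonempty ι₁ := nonempty_of_finrank_eq_two₁₃₅ Φ₁ h2₁
  haveI : Nonempty ι₂ := nonempty_of_finrank_eq_two₁₃₅ Φ₂ h2₂
  obtain ⟨n₁, U₁, hU₁, h2U₁, htr₁, hinj₁, hdim₁⟩ :=
    hX₁.exists_sl2StablePlanes_of_not_hodgeGroup_comm_of_endAlgRat_ne_bot_of_finrank_eq_two hη₁ h2₁ hnc₁ hE₁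
  obtain ⟨n₂, U₂, hU₂, h2U₂, htr₂, hinj₂, hdim₂⟩ :=
    hX₂.exists_sl2StablePlanes_of_not_hodgeGroup_comm_of_endAlgRat_ne_bot_of_finrank_eq_two hη₂ h2₂ hnc₂ hE₂
  exact hX₁.hodgeGroupC_prod_eq_blockDiagProd_of_stablePlanes_of_not_isIsogenous hX₂ hη₁ hη₂ hne U₁ U₂ hU₁ hU₂ h2U₁ h2U₂ htr₁
    htr₂ hinj₁ hinj₂ (by rw [hdim₁, Fintype.card_fin]) (by rw [hdim₂, Fintype.card_fin])

/-- **(D) FOR `Y₁ × Y₂`, BOTH HODGE GROUPS NON-COMMUTATIVE**: `Y₁`, `Y₂` polarised abelian surfaces with non-commutative Hodge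
groups ⟹ every power of `Y₁ × Y₂` has its Hodge ring generated by divisor classes (non-simple or isogenous or `End_ℚ = ℚ`:
g51-#7, g52-#2; otherwise the Hodge group splits by Hazama (3.2)(1) and both surfaces satisfy (D)).
[cite: MoonenZarhin1999LowDim, Thm. (0.1)(4) (p0001 L131–L135), §3 Thm. (3.2)(1), §5 (5.4) (p0009 L82–L94)] -/
theorem IsRiemannForm.forall_divisorClasses_powPeriod_prod_eq_hodgeClasses_of_not_hodgeGroup_comm_of_finrank_eq_two
    (hη₁ : IsRiemannForm Φ₁ η₁) (hη₂ : IsRiemannForm Φ₂ η₂) (h2₁ : finrank ℂ E₁ = 2) (h2₂ : finrank ℂ E₂ = 2)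
    (hnc₁ : ¬ ∀ M ∈ hodgeGroup Φ₁, ∀ N ∈ hodgeGroup Φ₁, M * N = N * M)
    (hnc₂ : ¬ ∀ M ∈ hodgeGroup Φ₂, ∀ N ∈ hodgeGroup Φ₂, M * N = N * M) :
    ∀ k p, divisorClasses (powPeriod (prodPeriod Φ₁ Φ₂) k) p = hodgeClasses (powPeriod (prodPeriod Φ₁ Φ₂) k) p := by
  haveI : Nonempty ι₁ := nonempty_of_finrank_eq_two₁₃₅ Φ₁ h2₁
  haveI : Nonempty ι₂ := nonempty_of_finrank_eq_two₁₃₅ Φ₂ h2₂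
  by_cases hX₁ : IsSimple Φ₁
  swap
  · exact hη₁.forall_divisorClasses_powPeriod_prod_eq_hodgeClasses_of_finrank_eq_two_of_not_isSimple_or_isIsogenous hη₂ h2₁ h2₂
      (Or.inl hX₁)
  by_cases hX₂ : IsSimple Φ₂
  swap
  · exact hη₁.forall_divisorClasses_powPeriod_prod_eq_hodgeClasses_of_finrank_eq_two_of_not_isSimple_or_isIsogenous hη₂ h2₁ h2₂
      (Or.inr (Or.inl hX₂))
  by_cases hiso : IsIsogenous Φ₂ Φ₁
  · exact hη₁.forall_divisorClasses_powPeriod_prod_eq_hodgeClasses_of_finrank_eq_two_of_not_isSimple_or_isIsogenous hη₂ h2₁ h2₂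
      (Or.inr (Or.inr hiso))
  by_cases hE₁ : endAlgRat Φ₁ = ⊥
  · exact hη₁.forall_divisorClasses_powPeriod_prod_eq_hodgeClasses_of_finrank_eq_two_of_endAlgRat_eq_bot_or hη₂ h2₁ h2₂ (Or.inl hE₁)
  by_cases hE₂ : endAlgRat Φ₂ = ⊥
  · exact hη₁.forall_divisorClasses_powPeriod_prod_eq_hodgeClasses_of_finrank_eq_two_of_endAlgRat_eq_bot_or hη₂ h2₁ h2₂
      (Or.inr (Or.inl hE₂))
  exact forall_divisorClasses_powPeriod_prod_eq_hodgeClasses_of_hodgeGroupC_prod_eq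
    (hX₁.hodgeGroupC_prod_eq_blockDiagProd_of_not_hodgeGroup_comm_of_finrank_eq_two hX₂ hη₁ hη₂ h2₁ h2₂ hiso hnc₁ hnc₂ hE₁ hE₂)
    (IsAbelianVariety.forall_divisorClasses_powPeriod_eq_hodgeClasses_of_finrank_eq_two ⟨η₁, hη₁⟩ h2₁)
    (IsAbelianVariety.forall_divisorClasses_powPeriod_eq_hodgeClasses_of_finrank_eq_two ⟨η₂, hη₂⟩ h2₂)

/-- **MOONEN–ZARHIN THM. (0.1)(4) FOR `Y₁ × Y₂` OUTSIDE THE CM × CM CASE.**  Polarised abelian surfaces `Y₁`, `Y₂` with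
`End_ℚ(Y₁) = ℚ`, or `End_ℚ(Y₂) = ℚ`, or `Y₁` or `Y₂` non-simple, or `Y₂ ∼ Y₁`, or `Hg(Y₁)` or `Hg(Y₂)` NON-commutative ⟹
`Y₁ × Y₂` satisfies condition (D).  (What remains of (0.1)(4) for `X ∼ Y₁ × Y₂` is «both simple of CM type, non-isogenous»:
Prop. (4.2).)  [cite: MoonenZarhin1999LowDim, Thm. (0.1)(4) (p0001 L131–L135), §3 Thm. (3.2), §5 (5.4)–(5.5) (p0009 L82–L106)] -/
theorem IsRiemannForm.forall_divisorClasses_powPeriod_prod_eq_hodgeClasses_of_finrank_eq_two_of_not_hodgeGroup_comm_or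
    (hη₁ : IsRiemannForm Φ₁ η₁) (hη₂ : IsRiemannForm Φ₂ η₂) (h2₁ : finrank ℂ E₁ = 2) (h2₂ : finrank ℂ E₂ = 2)
    (h : endAlgRat Φ₁ = ⊥ ∨ endAlgRat Φ₂ = ⊥ ∨ ¬ IsSimple Φ₁ ∨ ¬ IsSimple Φ₂ ∨ IsIsogenous Φ₂ Φ₁ ∨
      (¬ ∀ M ∈ hodgeGroup Φ₁, ∀ N ∈ hodgeGroup Φ₁, M * N = N * M) ∨ ¬ ∀ M ∈ hodgeGroup Φ₂, ∀ N ∈ hodgeGroup Φ₂, M * N = N * M) :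
    ∀ k p, divisorClasses (powPeriod (prodPeriod Φ₁ Φ₂) k) p = hodgeClasses (powPeriod (prodPeriod Φ₁ Φ₂) k) p := by
  rcases h with h | h | h | h | h | h | h
  · exact hη₁.forall_divisorClasses_powPeriod_prod_eq_hodgeClasses_of_finrank_eq_two_of_endAlgRat_eq_bot_or' hη₂ h2₁ h2₂ (Or.inl h)
  · exact hη₁.forall_divisorClasses_powPeriod_prod_eq_hodgeClasses_of_finrank_eq_two_of_endAlgRat_eq_bot_or' hη₂ h2₁ h2₂
      (Or.inr (Or.inl h))
  · exact hη₁.forall_divisorClasses_powPeriod_prod_eq_hodgeClasses_of_finrank_eq_two_of_endAlgRat_eq_bot_or' hη₂ h2₁ h2₂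
      (Or.inr (Or.inr (Or.inl h)))
  · exact hη₁.forall_divisorClasses_powPeriod_prod_eq_hodgeClasses_of_finrank_eq_two_of_endAlgRat_eq_bot_or' hη₂ h2₁ h2₂
      (Or.inr (Or.inr (Or.inr (Or.inl h))))
  · exact hη₁.forall_divisorClasses_powPeriod_prod_eq_hodgeClasses_of_finrank_eq_two_of_endAlgRat_eq_bot_or' hη₂ h2₁ h2₂
      (Or.inr (Or.inr (Or.inr (Or.inr (Or.inl h)))))
  · by_cases h₂ : ∀ M ∈ hodgeGroup Φ₂, ∀ N ∈ hodgeGroup Φ₂, M * N = N * M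
    · exact hη₁.forall_divisorClasses_powPeriod_prod_eq_hodgeClasses_of_not_hodgeGroup_comm_of_hodgeGroup_comm_of_finrank_eq_two hη₂
        h2₁ h2₂ h h₂
    · exact hη₁.forall_divisorClasses_powPeriod_prod_eq_hodgeClasses_of_not_hodgeGroup_comm_of_finrank_eq_two hη₂ h2₁ h2₂ h h₂
  · by_cases h₁ : ∀ M ∈ hodgeGroup Φ₁, ∀ N ∈ hodgeGroup Φ₁, M * N = N * M
    · exact hη₁.forall_divisorClasses_powPeriod_prod_eq_hodgeClasses_of_hodgeGroup_comm_of_not_hodgeGroup_comm_of_finrank_eq_two hη₂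
        h2₁ h2₂ h₁ h
    · exact hη₁.forall_divisorClasses_powPeriod_prod_eq_hodgeClasses_of_not_hodgeGroup_comm_of_finrank_eq_two hη₂ h2₁ h2₂ h₁ h

/-- `IsAbelianVariety` form of the assembly: (0.1)(4) for `Y₁ × Y₂` unless both Hodge groups are commutative (and both simple,
non-isogenous, `End_ℚ ≠ ℚ`). [cite: MoonenZarhin1999LowDim, Thm. (0.1)(4) and §5 (5.4)–(5.5)] -/
theorem IsAbelianVariety.forall_divisorClasses_powPeriod_prod_eq_hodgeClasses_of_finrank_eq_two_of_not_hodgeGroup_comm_or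
    (hA₁ : IsAbelianVariety Φ₁) (hA₂ : IsAbelianVariety Φ₂) (h2₁ : finrank ℂ E₁ = 2) (h2₂ : finrank ℂ E₂ = 2)
    (h : endAlgRat Φ₁ = ⊥ ∨ endAlgRat Φ₂ = ⊥ ∨ ¬ IsSimple Φ₁ ∨ ¬ IsSimple Φ₂ ∨ IsIsogenous Φ₂ Φ₁ ∨
      (¬ ∀ M ∈ hodgeGroup Φ₁, ∀ N ∈ hodgeGroup Φ₁, M * N = N * M) ∨ ¬ ∀ M ∈ hodgeGroup Φ₂, ∀ N ∈ hodgeGroup Φ₂, M * N = N * M) :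
    ∀ k p, divisorClasses (powPeriod (prodPeriod Φ₁ Φ₂) k) p = hodgeClasses (powPeriod (prodPeriod Φ₁ Φ₂) k) p := by
  obtain ⟨η₁, hη₁⟩ := hA₁
  obtain ⟨η₂, hη₂⟩ := hA₂
  exact hη₁.forall_divisorClasses_powPeriod_prod_eq_hodgeClasses_of_finrank_eq_two_of_not_hodgeGroup_comm_or hη₂ h2₁ h2₂ h

/-- **THE REMAINING CASE, STATED AS A REDUCTION**: if `Y₁ × Y₂` FAILS condition (D) for two polarised abelian surfaces, then both
are simple, non-isogenous, with `End_ℚ ≠ ℚ` and COMMUTATIVE Hodge groups (CM × CM — where MZ Prop. (4.2) applies).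
[cite: MoonenZarhin1999LowDim, Thm. (0.1)(4), §4 Prop. (4.2) and §5 (5.5) (p0009 L103–L106)] -/
theorem IsRiemannForm.isSimple_and_hodgeGroup_comm_of_exists_divisorClasses_powPeriod_prod_ne_of_finrank_eq_two
    (hη₁ : IsRiemannForm Φ₁ η₁) (hη₂ : IsRiemannForm Φ₂ η₂) (h2₁ : finrank ℂ E₁ = 2) (h2₂ : finrank ℂ E₂ = 2)
    (h : ∃ k p, divisorClasses (powPeriod (prodPeriod Φ₁ Φ₂) k) p ≠ hodgeClasses (powPeriod (prodPeriod Φ₁ Φ₂) k) p) :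
    IsSimple Φ₁ ∧ IsSimple Φ₂ ∧ ¬ IsIsogenous Φ₂ Φ₁ ∧ endAlgRat Φ₁ ≠ ⊥ ∧ endAlgRat Φ₂ ≠ ⊥ ∧
      (∀ M ∈ hodgeGroup Φ₁, ∀ N ∈ hodgeGroup Φ₁, M * N = N * M) ∧ ∀ M ∈ hodgeGroup Φ₂, ∀ N ∈ hodgeGroup Φ₂, M * N = N * M := by
  obtain ⟨k, p, hkp⟩ := h
  have H := fun h' ↦ hkp (hη₁.forall_divisorClasses_powPeriod_prod_eq_hodgeClasses_of_finrank_eq_two_of_not_hodgeGroup_comm_or hη₂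
    h2₁ h2₂ h' k p)
  refine ⟨?_, ?_, ?_, ?_, ?_, ?_, ?_⟩
  · by_contra hc; exact H (Or.inr (Or.inr (Or.inl hc)))
  · by_contra hc; exact H (Or.inr (Or.inr (Or.inr (Or.inl hc))))
  · exact fun hc ↦ H (Or.inr (Or.inr (Or.inr (Or.inr (Or.inl hc)))))
  · exact fun hc ↦ H (Or.inl hc)
  · exact fun hc ↦ H (Or.inr (Or.inl hc))
  · by_contra hc; exact H (Or.inr (Or.inr (Or.inr (Or.inr (Or.inr (Or.inl hc))))))
  · by_contra hc; exact H (Or.inr (Or.inr (Or.inr (Or.inr (Or.inr (Or.inr hc))))))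

end Surfaces

end ComplexTorus

end Literature.Geometry.Kaehler
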